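import Literature.IUT.HodgeArakelov.GaloisPairCyclotomesCompatibleOfGalois
import Literature.IUT.HodgeArakelov.EtaleThetaDataOfSettingHcycOfHgal
import HarnessLib

/-!
# [IUTchII] Cor. 1.11 (b): the `Π`-side input at Cor. 1.10's genuine family FROM (HGAL) ALONE —
# the one-line composition of abc-iut-w5-d145's «(HGAL) ∧ (HCYC) ⟹ (C′)» with abc-iut-w5-d169's «(HGAL) ⟹ (HCYC)»

Mochizuki, *Inter-universal Teichmüller theory II*, §1, Cor. 1.11 (b), kurims manuscript (Dec. 2020) p. 49
[claim: Mochizuki2012, status: disputed] (IUTchII §1 Cor 1.11, kurims p.49); [AbsTopIII] Cor. 1.10 pp. 41–44 ((HGAL));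
[EtTh] Cor. 2.18 (i) p. 60 (F-0620), §1 pp. 12–13 (the class-R origin clauses). abc-iut cell, layer L6, nodes
`IUTchII:Cor1.11` (holder lineage abc-iut-w5-d145) and `IUTchII:Prop3.4(i)` (P3) (holder lineage abc-iut-w5-d169);
seat abc-iut-w5-d145 (gen 5). PROOF-ONLY: 0 definitions, no `Prop`-valued fact, nothing restated.

WHAT IS CLOSED. abc-iut-w5-d145 (gen 4) proved `EtaleLevels.nonempty_galCorPiXInput_familyLim_of_thetaMod_natural`
(p440299): «∀ γ ∃ τ, (HGAL) ∧ (HCYC)_thetaMod» ⟹ the `Π`-side input `GalCorPiXInput A familyLim` of Cor. 1.11 (b) at Cor. 1.10's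
GENUINE family is inhabited (GAP-LEDGER G-w5d145-2). abc-iut-w5-d169 (gen 5) proved
`EtaleThetaDataOfSetting.hcyc_of_hgal` (p450689): (HGAL) ⟹ (HCYC) for every all-level cyclotome tower, modulo the
class-R [EtTh] §1 origin clauses `IsEtThOrigin`, `hYcl`, `IsTateOrigin` and the quotient-map clause `hq` (D-G-w5d169-3 #5).
THIS FILE composes them:

* `EtaleLevels.thetaMod_natural_of_hgal` — the DICTIONARY: for ANY compatible system of identifications `mods`/`hmods`
  (re-chained to a `CyclotomeTower` over the cofinal chain `chainSet 1 1` by abc-iut-w4-d024's `CyclotomeTower.ofAllLevels`,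
  whose all-level identifications agree with `mods` on elements by `hmods`), a topological automorphism `α` of `Π^tp_{X̲̲}`
  lying over `Inn(τ)|_{G_K}` ((HGAL)) is `thetaMod_n`-NATURAL at every level `n`:
  `thetaMod_n (α g) = galMuN τ (thetaMod_n g)` — `thetaMod_n = (mods n).red ∘ toLDelta` (`rigidData`, definitional) and
  `ᾱ(φ g) = φ(α g)` (`rangeAutOfCor218i_phiR`), so this IS `hcyc_of_hgal`'s conclusion;
* **`EtaleLevels.nonempty_galCorPiXInput_familyLim_of_hgalois`** — «∀ α ∃ τ ∈ G_{ℚ_p}, (HGAL)» ALONE (plus the class-R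
  clauses) ⟹ `Nonempty (GalCorPiXInput A familyLim)`: the typed residual of node IUTchII:Cor1.11's `Π`-side is now EXACTLY
  (HGAL) = [AbsTopIII] Cor. 1.10 (Galois side of a topological automorphism), the FACT-class input of record (C-R25), for
  every Ex. 1.8 interface `A` and every compatible `mods` — no cyclotomic functoriality is owed any more.
Nothing here asserts anything of [IUTchII], [EtTh] or [AbsTopIII]; (HGAL) and the class-R clauses stay hypotheses BY NAME;
no side is taken on [IUTchIII] Cor. 3.12; typed ≠ proved for the binders.
-/

noncomputable section

open Topology

namespace Literature.IUT.HodgeArakelov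

open CategoryTheory
open Literature.AnabelianGeometry.AbsoluteAnabelian

namespace EtaleLevels

open Literature.AnabelianGeometry.EtaleTheta Literature.AnabelianGeometry.SemiGraphs
open Literature.AnabelianGeometry.EtaleTheta.ThetaSetting
open scoped Literature.AnabelianGeometry.EtaleTheta

variable {p : ℕ} [Fact p.Prime] {D : Literature.AnabelianGeometry.EtaleTheta.ThetaSetting p}
  {E : D.EtaleThetaData} {l : ℕ} (C : E.DoubleUnderline l) (hC : D.Compat) (hS : D.Sec2Hyps)
  (hl : l.Prime) (hp2 : p ≠ 2) (hpl : p ≠ l) (hζ : ∃ ζ : D.K, IsPrimitiveRoot ζ (4 * l))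
  (mods : ∀ M : ℕ+, D.CyclotomeMod l M)
  (f : contCocycles D.toTheta D.DeltaTheta C.GtpYdduu) (hf : f ∈ C.rootCocycles hC)
  (hmods : ∀ (M M' : ℕ+) (h : (M : ℕ) ∣ (M' : ℕ)) (x : D.lDeltaTheta l),
    MuN.red p M M' h ((mods M').red x) = (mods M).red x)
  (h15 : Literature.AnabelianGeometry.EtaleTheta.ThetaSetting.Prop15iii E hC) (L : C.CuspLabels)
  (hZ : ∀ M : ℕ+, Nonempty (ModelCyclotomes.lDeltaQuot (C.rigidData (mods M) hC hS h15 L) ≃*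
    Literature.IUT.HodgeTheaters.ZHat))
  (h218i : ∀ M : ℕ+, (levelRigid C hC hS mods h15 L M).Cor218_i)

include hmods h218i in
/-- **The dictionary (HCYC)_tower ⟹ (HCYC)_thetaMod, hence (HGAL) ⟹ (HCYC)_thetaMod.** For ANY compatible system `mods`
(re-chained to abc-iut-w4-d024's tower `CyclotomeTower.ofAllLevels mods hmods` over the cofinal chain `chainSet 1 1`), under
F-0620 ([EtTh] Cor. 2.18 (i)) at every level and the class-R origin clauses of abc-iut-L2 (`IsEtThOrigin`, `hYcl`,
`IsTateOrigin`, `hq`): a topological automorphism `α` of `Π^tp_{X̲̲}` lying over `Inn(τ)|_{G_K}` satisfies, at every level `n`,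
`thetaMod_n (α g) = τ · thetaMod_n g` on `φ⁻¹(l·Δ_Θ)` — abc-iut-w5-d169's `EtaleThetaDataOfSetting.hcyc_of_hgal` read through
`thetaMod_n = (mods n).red ∘ toLDelta` and `ᾱ(φ g) = φ(α g)` (`rangeAutOfCor218i_phiR`).
[claim: Mochizuki2012, status: disputed] (IUTchII §1 Cor 1.11, kurims p.49) -/
theorem thetaMod_natural_of_hgal (hO : D.IsEtThOrigin)
    (hYcl : (D.DtpY.map D.toHat.toMonoidHom).topologicalClosure ≤
      D.DtpY.map D.toHat.toMonoidHom ⊔ (⁅⁅D.DeltaHat, D.DeltaHat⁆, D.DeltaHat⁆).topologicalClosure)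
    (hT : D.IsTateOrigin) (hq : IsQuotientMap D.toTheta)
    (α : (EtaleThetaDataOfSetting.Pi C) ≃ₜ* (EtaleThetaDataOfSetting.Pi C)) (τ : GQp p)
    (hgal : ∀ x : EtaleThetaDataOfSetting.Pi C,
      EtaleThetaDataOfSetting.aug C (α x) = τ * EtaleThetaDataOfSetting.aug C x * τ⁻¹)
    (n : ℕ+) (g : ↥(levelRigid C hC hS mods h15 L n).lDeltaTheta)
    (hg : α g ∈ (levelRigid C hC hS mods h15 L n).lDeltaTheta) :
    (levelRigid C hC hS mods h15 L n).thetaMod ⟨α g, hg⟩ =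
      galMuN p n τ ((levelRigid C hC hS mods h15 L n).thetaMod g) := by
  -- re-chain `mods` to a tower over the cofinal chain `chainSet 1 1`
  let T : D.CyclotomeTower l (chainSet 1 1) :=
    CyclotomeTower.ofAllLevels mods hmods (one_mem_chainSet 1 1) (chainSet_cofinal 1 1)
      (chainSet_total (dvd_refl _))
  -- its all-level identifications agree with `mods` on elements
  have hTm : ∀ (M : ℕ+) (x : D.lDeltaTheta l), (T.modAll M).red x = (mods M).red x := by
    intro M x
    obtain ⟨e, he, hMe⟩ := chainSet_cofinal 1 1 M
    rw [T.modAll_red_eq_redVia M ⟨e, he⟩ (PNat.dvd_iff.1 hMe), CyclotomeTower.redVia_apply]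
    exact hmods M e (PNat.dvd_iff.1 hMe) x
  -- abc-iut-w5-d169's (HGAL) ⟹ (HCYC) for the tower `T`, at level `1` of F-0620
  have key := EtaleThetaDataOfSetting.hcyc_of_hgal C hO hYcl hT hS hq (mods 1) hC h15 L
    (levelRigid C hC hS mods h15 L 1) rfl (h218i 1) T α τ hgal n (C.toLDelta g) (C.toLDelta ⟨α g, hg⟩) ?_
  · rw [hTm, hTm] at key
    exact key
  · -- `ᾱ (φ g) = φ (α g)`
    have h := EtaleThetaDataOfSetting.rangeAutOfCor218i_phiR C (mods 1) hq hC hS h15 L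
      (levelRigid C hC hS mods h15 L 1) rfl (h218i 1) α g
    have h' := congrArg Subtype.val h
    exact h'

/-- **[IUTchII] Cor. 1.11 (b), `Π`-side, FROM (HGAL) ALONE.** For the genuine data of a `ThetaSetting` at an [EtTh] origin
(class-R clauses `IsEtThOrigin`, `hYcl`, `IsTateOrigin`, `hq`, BY NAME), under F-0620 at every level, for EVERY compatible system
`mods` and EVERY Ex. 1.8 interface `A`: if every topological automorphism of `Π^tp_{X̲̲}` lies over an inner automorphism of
`G_{ℚ_p}` restricted to `G_K` — (HGAL), the Galois side of [AbsTopIII] Cor. 1.10, the FACT-class input of record — then the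
`Π`-side input `GalCorPiXInput A familyLim` of Cor. 1.11 (b) at Cor. 1.10's genuine family is INHABITED.  (= p440299
`nonempty_galCorPiXInput_familyLim_of_thetaMod_natural` ∘ `thetaMod_natural_of_hgal`.)
[claim: Mochizuki2012, status: disputed] (IUTchII §1 Cor 1.11, kurims p.49) -/
theorem nonempty_galCorPiXInput_familyLim_of_hgalois
    [CompactSpace (setting C hC hS hl hp2 hpl hζ mods f hf).Gk] (A : AbsTopMonoids (setting C hC hS hl hp2 hpl hζ mods f hf))
    (hO : D.IsEtThOrigin)
    (hYcl : (D.DtpY.map D.toHat.toMonoidHom).topologicalClosure ≤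
      D.DtpY.map D.toHat.toMonoidHom ⊔ (⁅⁅D.DeltaHat, D.DeltaHat⁆, D.DeltaHat⁆).topologicalClosure)
    (hT : D.IsTateOrigin) (hq : IsQuotientMap D.toTheta)
    (hHGAL : ∀ α : (EtaleThetaDataOfSetting.Pi C) ≃ₜ* (EtaleThetaDataOfSetting.Pi C), ∃ τ : GQp p,
      ∀ x : EtaleThetaDataOfSetting.Pi C,
        EtaleThetaDataOfSetting.aug C (α x) = τ * EtaleThetaDataOfSetting.aug C x * τ⁻¹) :
    Nonempty (GalCorPiXInput A (familyLim C hC hS hl hp2 hpl hζ mods f hf hmods h15 L hZ (h218i 1))) := by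
  refine nonempty_galCorPiXInput_familyLim_of_thetaMod_natural C hC hS hl hp2 hpl hζ mods f hf hmods h15 L hZ h218i A
    fun γ => ?_
  obtain ⟨τ, hτ⟩ := hHGAL (IsoClass.homIso γ)
  exact ⟨τ, fun x => hτ x, fun n g hg =>
    thetaMod_natural_of_hgal C hC hS mods hmods h15 L h218i hO hYcl hT hq (IsoClass.homIso γ) τ hτ n g hg⟩

end EtaleLevels

end Literature.IUT.HodgeArakelov

end
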